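import Summits.QuantumFields.YangMills.Theorems.UnitScaleTiltProp7SymAvgTwEq137
import Summits.QuantumFields.YangMills.Theorems.UnitScaleTiltProp7B8Prop7Div
import Summits.QuantumFields.YangMills.Theorems.UnitScaleTiltProp7PV3CDELogChart
import Summits.QuantumFields.YangMills.Theorems.UnitScaleTiltProp7Bound20SymLog
import HarnessLib

/-!
# Route `UnitScaleTilt`, crux K1 child «MinimiserStabilityRegPr» (stmt-QuantumFields-19200), skeleton v10, stub `stub_existenceMinimalOrbit` (EX), route (α) — **(CH-KNIT v2-tw), MEMBER
# LEVEL**: the CHART-112 binder `hChart` of `stubEX_of_displayedRows(_w)` (five conjuncts: `X` Hermitian-traceless, (19)-size, (20) `AvgCondPrint`, (21) `IsLandauPrint`, E–L) at ONE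
# member, FROM THE TWISTED CHART OF RECORD (OWNER RULING g26-№1 Σ-TWIST, option (T)): [Balaban1985Variational] Prop. 3 for the twisted symmetric chart `Chart47T3tw … U₀ H` with
# (45)–(46)-tw `QTw U₀ ∘ H = id` (displayed), CHART-Σ (★w5 g0, PROVED elsewhere), the (20)-FIBRE CLAUSE AS A THEOREM (★w5-20520 g3's `Prop7SymAvgTwEq137.fibreClause_of_chart47tw`:
# (48)-tw ∘ datum ∘ (1.37)^cov ∘ ✓p605215), [Balaban1985RegularSpaces] Prop. 7 for the regularity of the chart point (`Prop7B8Prop7Div.regPr_emb15_of_in19`), and the DISPLAYED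
# remainder `hXtw` = (112) ∘ Prop. 5 ∘ (123)–(140) ∘ (102)–(103) ∘ E–L in the twisted letters

Cell `ym3-torus`, width seat `ym-ust-19200-w2` (gen 3; KNIT RULER per ★★OWNER g26 RULING №1 (4) and ACK 4 (a)).  THEOREMS ONLY (0 `def`, 0 `sorry`).  CONDITIONAL: the stub stays OPEN;
`--supports stmt-QuantumFields-19200 --as helper`, count-neutral.  YM₃ on T³ is a ladder rung (R3), not the Clay problem; nothing here claims the stub, the crux, d = 4 or the mass gap.

THE PRINT.  [Balaban1985Variational] p. 285: «We will construct the linearizing transformation in the form A = A′ − HD(A′), (47) … Q_j(η(A′ − HD(A′))) = LʲηQ_jA′ (48)»; p. 293–294: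
«(102) … (103) A′ = A₁ + H₁B … Q𝔊 = 0, RD*𝔊 = 0 … A₁ + 𝔊J + 𝔊((δ/δA′)V)(A₁ + H₁B) = 0. (111) … This solution determines a critical configuration U₁ by the transformation (112)»;
p. 299: «the transformation (47) applied to A′₁ yields the configuration A′₁ − HD(A′₁) = (1/iη) log U₁ satisfying all the conditions (19)–(21) with ε₂ = O(1)C₁B₃ε₁ … we apply to it a
gauge transformation u satisfying the conditions R̄₀u = 1 on Λ_j and such that the gauge transformed configuration (U₁U₀)ᵘ satisfies the axial gauge conditions Ax_k(𝔅_k, U₀)».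
[Balaban1985RegularSpaces] p. 82 (1.37): «Q_j(U₀, ηA) = B on Λ_j»; Prop. 7 p. 98.  [Balaban1985BackgroundPropagators] p. 392: the averaging operation of the chart is the double-bar
average U̿ of [Balaban1985Averaging] (89)–(92) — the route's `Prop7SymAvgTw.logChartTw ∕ QTw ∕ CmapTw ∕ Chart47T3tw` (★w5-20520 g3, p605671).

THE KNIT AT ONE MEMBER (no new analysis).  Given the twisted chart `h47 : Chart47T3tw F n K h C₂ ε U₀ H` and `hQH : QTw U₀ ∘ H = id` (print's Prop. 3 with (45)–(46), DISPLAYED), CHART-Σ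
`hSig` (PROVED by `Prop7ChartSigmaT3OfRegPr.chartSigmaT3_of_regPr`), and the displayed remainder `hXtw` — every solution `A₁` of (111) in the (115)-ball `ε₄` has a chart parameter
`A′` in the `ε`-ball whose TWISTED LINEAR AVERAGE IS PRINT'S DATUM, `Q(U₀)A′ = log(V·Ū₀⁻¹)` ((102) `Q𝔊 = 0`, (103), `QH₁ = id`, (20)), and whose chart image `A′ − HD(A′) = iX` has `X`
Hermitian-traceless of (19)-size `≤ M(‖A₁‖ + ‖H₁B‖)`, (21) `IsLandauPrint`, and E–L-critical at its restricted axial representatives — the (20)-conjunct `AvgCondPrint` FOLLOWS: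
CHART-Σ gives the restricted axial `u` at size `< e`; `fibreClause_of_chart47tw` puts `(e^{iX}U₀)ᵘ` in `𝔅_k(V)`, its regularity input for `e^{iX}U₀` being [Balaban1985RegularSpaces]
Prop. 7 at the T³ carrier (`regPr_emb15_of_in19` ∘ `in19_expHermField_of_nMax19_lt`, radius `178(ε₀ + e)`), its `log` window for the datum being (14) `CloseAvg` (§1), its `log`
window for the twisted average of the chart point DISPLAYED (`hwin`; supplier located: ★w4-20520's `Prop7SymAvgRelativeBoundT3.norm_relIter_sub_one_le_T3` + a frame bound).

WHAT IS PROVED.  §1 `val_inv_unitsField_toUField`, `norm_datum_sub_one_lt_of_closeAvg` ((14) ⟹ the datum `V·Ū₀⁻¹` is in the `log` window).  §2 ★★ **`hChart_of_piecesTw`** — CHART-112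
(five conjuncts, the `hChart` shape of `Prop7StubEXOfDisplayedRows(W)` at one member and background) from {`Chart47T3tw` + (46)-tw, CHART-Σ, `hwin`, `hXtw`} and the windows
`10⁷L³·178(ε₀ + e) ≤ 1`, `e ≤ 1∕20`, `ε₀ ≤ 1∕16`, `b ≤ 1`, `0 ≤ M`, `M(ε₄ + ‖H₁B‖) < e`.  HONEST SCOPE: by-name bookkeeping over landed letters; `Chart47T3tw`, (46)-tw, `hwin`, `hXtw`
stay DISPLAYED (their content is the EX nodes (CH47-tw) = Prop. 3-tw ⇐ (44)-tw [L, not built], (46)-tw ⇐ (R1)+(3e), (CH5EL-tw) = (112)∘Prop. 5∘(123)–(140)∘(102)–(103)∘E–L [XL]).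

References: T. Bałaban, CMP 102 (1985) 277–309 [Balaban1985Variational] ((19)–(21) p.281, (44)–(49) p.285, Prop. 3 p.289, (102)–(103) p.293, (111)–(112) p.294, Prop. 5 p.294,
(123)–(140) pp.296–299, p.299); CMP 99 (1985) 75–102 [Balaban1985RegularSpaces] ((1.29)–(1.31) pp.81–82, (1.37) p.82, Prop. 7 p.98); CMP 99 (1985) 389–434
[Balaban1985BackgroundPropagators] (p.392, (3.13)–(3.14) p.393); CMP 98 (1985) 17–51 [Balaban1985Averaging] ((89)–(92) p.31).
-/

set_option autoImplicit false

noncomputable section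

open scoped Matrix.Norms.L2Operator

namespace Summit.QuantumFields.YangMills.Theorems.Prop7ChartPiecesTw

open NormedSpace
open Literature.MathematicalPhysics.QuantumFieldTheory.Balaban1983to89
open Literature.MathematicalPhysics.QuantumFieldTheory.Balaban1983to89.T3ContinuumYM3Torus
open Literature.MathematicalPhysics.QuantumFieldTheory.Balaban1983to89.T3UnitLawDensityEML (ℰp)
open Literature.MathematicalPhysics.QuantumFieldTheory.Balaban1983to89.T3TiltDescent (descendTo)
open Literature.MathematicalPhysics.QuantumFieldTheory.Balaban1983to89.T3ConstrainedMinimiser (fibre)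
open Literature.MathematicalPhysics.QuantumFieldTheory.Balaban1983to89.T3PrintedRegularMinimiser (RegPr)
open Literature.MathematicalPhysics.QuantumFieldTheory.Balaban1983to89.T3PrintedMinimiserExistence (regPr_mono)
open Literature.MathematicalPhysics.QuantumFieldTheory.Balaban1983to89.T3SectALandauChart (In19 emb15 CloseAvg)
open B9SectCLatticeCarrier (Bond)
open B10Eq27TorusAxialLog (unitsField toUField val_unitsField)
open B11Eq115Space (NegSize Space115)
open B11Eq111FrakG (nabla115)
open B11Eq98CurrentSlot (Jcur)
open B11Prop3Model (Dfix)
open MatrixLog (mlog)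
open Summit.QuantumFields.YangMills.Theorems.Prop7TPrint (nMax19 expHermField expHermField_apply coe_expHerm)
open Summit.QuantumFields.YangMills.Theorems.Prop7SPrint (AvgCondPrint IsLandauPrint RestrictedPrint IsAxialPrint)
open Summit.QuantumFields.YangMills.Theorems.Prop7SectET3Transport (periodsT3 bgOfCfg)
open Summit.QuantumFields.YangMills.Theorems.Prop7ChartT3 (ChartSigmaT3)
open Summit.QuantumFields.YangMills.Theorems.Prop7SymAvgTw (dbarTw QTw CmapTw Chart47T3tw)
open Summit.QuantumFields.YangMills.Theorems.Prop7SymAvgTwEq137 (fibreClause_of_chart47tw)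
open Summit.QuantumFields.YangMills.Theorems.Prop7B8Prop7Div (regPr_emb15_of_in19)
open Summit.QuantumFields.YangMills.Theorems.Prop7PV3CDELogChart (in19_expHermField_of_nMax19_lt)

variable (F : T3Family) {n K : ℕ} (h : n ≤ K)

/-! ## §1 (14) puts print's datum `V·Ū₀⁻¹` in the `log` window -/

/-- The inverse of the unit `W♭(c)` of an `SU(2)` field read in `GL₂(ℂ)` is the adjoint matrix `W(c)^*`. [folklore] -/
theorem val_inv_unitsField_toUField {P : Params} (W : GaugeField P 0 (Matrix.specialUnitaryGroup (Fin 2) ℂ)) (c : PBond P 0) :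
    (((unitsField (toUField W) c)⁻¹ : (Matrix (Fin 2) (Fin 2) ℂ)ˣ) : Matrix (Fin 2) (Fin 2) ℂ)
      = star (((W c : Matrix.specialUnitaryGroup (Fin 2) ℂ)) : Matrix (Fin 2) (Fin 2) ℂ) := by
  rw [← Units.inv_eq_val_inv]
  rfl

/-- **(14) ⟹ THE DATUM IS IN THE `log` WINDOW**: `|Ū₀(c) − V(c)| < b ≤ 1` gives `‖V♭(c)·Ū₀♭(c)⁻¹ − 1‖ < 1` (`Ū₀(c)` unitary, so `‖V·Ū₀^* − 1‖ = ‖Ū₀ − V‖`, ★w4-19200 g2's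
`Prop7Bound20SymLog.norm_mul_star_descendTo_sub_one`). [cite: Balaban1985Variational, (14) p.280, (20) p.281; Balaban1985Averaging, (26) p.22] -/
theorem norm_datum_sub_one_lt_of_closeAvg {b : ℝ} (hb : b ≤ 1) (V : GaugeField (F.P n) 0 (Matrix.specialUnitaryGroup (Fin 2) ℂ))
    (U₀ : GaugeField (F.P K) 0 (Matrix.specialUnitaryGroup (Fin 2) ℂ)) (hclose : CloseAvg F n K h b V U₀) (c : PBond (F.P n) 0) :
    ‖((unitsField (toUField V) c * (unitsField (toUField (descendTo F ℰp n K h U₀)) c)⁻¹ : (Matrix (Fin 2) (Fin 2) ℂ)ˣ) : Matrix (Fin 2) (Fin 2) ℂ) - 1‖ < 1 := by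
  have hV : ((unitsField (toUField V) c : (Matrix (Fin 2) (Fin 2) ℂ)ˣ) : Matrix (Fin 2) (Fin 2) ℂ)
      = ((V c : Matrix.specialUnitaryGroup (Fin 2) ℂ) : Matrix (Fin 2) (Fin 2) ℂ) := rfl
  rw [Units.val_mul, val_inv_unitsField_toUField, hV, Prop7Bound20SymLog.norm_mul_star_descendTo_sub_one F h V U₀ c]
  exact (hclose c).trans_le hb

/-! ## §2 CHART-112 at one member from the twisted chart, CHART-Σ, the (20)-fibre theorem and the displayed remainder -/

/-- ★★ **CHART-112 (five conjuncts) FROM THE TWISTED PIECES, one member and background**: `U₀ ∈ 𝔘_k(ε₀)` with `|Ū₀ − V| < b ≤ 1`; print's Prop. 3 for the TWISTED symmetric chart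
`Chart47T3tw … C₂ ε U₀ H` with (45)–(46)-tw `QTw U₀ ∘ H = id` (DISPLAYED); CHART-Σ `ChartSigmaT3 … e U₀` (PROVED elsewhere); the `log` window `hwin` of the twisted average at chart
points of (19)-size `< e` (DISPLAYED); and the displayed remainder `hXtw` — every solution `A₁` of (111) in the (115)-ball `ε₄` has a chart parameter `A′`, `‖A′‖ < ε`, with
`Q(U₀)A′ = log(V·Ū₀⁻¹)` ((102)–(103), (20)) and chart image `A′ − HD(A′) = iX`, `X` Hermitian-traceless, `nMax19 X ≤ M(‖A₁‖ + ‖H₁B‖)`, (21), E–L — give, under the windows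
`0 ≤ M`, `M(ε₄ + ‖H₁B‖) < e`, `e ≤ 1∕20`, `ε₀ ≤ 1∕16`, `10⁷L³·178(ε₀ + e) ≤ 1`, the CHART-112 conclusion: `X` with (19)-size, **(20) `AvgCondPrint`** (CHART-Σ's restricted axial `u`
+ ★w5-20520 g3's `fibreClause_of_chart47tw`, the chart point's regularity by [Balaban1985RegularSpaces] Prop. 7 `regPr_emb15_of_in19`), (21) and E–L.
[cite: Balaban1985Variational, (112) p.294, Prop. 5 p.294, Prop. 3 p.289, (47)–(49) p.285, (102)–(103) p.293, (19)–(21) p.281, p.299; Balaban1985RegularSpaces, (1.29)–(1.31) pp.81–82, (1.37) p.82, Prop. 7 p.98] -/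
theorem hChart_of_piecesTw [Fact (0 < (F.L : ℝ))] [Fact (0 < ((F.L : ℝ)⁻¹) ^ (K - n))] {ε₀ b ε₄ M e C₂ ε : ℝ}
    (hε₀ : 0 < ε₀) (hε₀16 : ε₀ ≤ 1 / 16) (he0 : 0 < e) (he20 : e ≤ 1 / 20) (hb : b ≤ 1)
    (hw137 : 10 ^ 7 * (F.L : ℝ) ^ 3 * (178 * (ε₀ + e)) ≤ 1)
    {V : GaugeField (F.P n) 0 (Matrix.specialUnitaryGroup (Fin 2) ℂ)} {U₀ : GaugeField (F.P K) 0 (Matrix.specialUnitaryGroup (Fin 2) ℂ)}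
    (hreg : RegPr F n K ε₀ U₀) (hclose : CloseAvg F n K h b V U₀)
    {𝒢 : NegSize (F.L : ℝ) (((F.L : ℝ)⁻¹) ^ (K - n)) (fun _ : Bond 3 (periodsT3 F K) => K - n) 3 (Matrix (Fin 2) (Fin 2) ℂ) →L[ℂ]
          Space115 (F.L : ℝ) (((F.L : ℝ)⁻¹) ^ (K - n)) (fun _ : Bond 3 (periodsT3 F K) => K - n) (fun _ : Bond 3 (periodsT3 F K) × Fin 3 => K - n)
            (nabla115 (((F.L : ℝ)⁻¹) ^ (K - n)) (bgOfCfg F K U₀))}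
    {W : Space115 (F.L : ℝ) (((F.L : ℝ)⁻¹) ^ (K - n)) (fun _ : Bond 3 (periodsT3 F K) => K - n) (fun _ : Bond 3 (periodsT3 F K) × Fin 3 => K - n)
            (nabla115 (((F.L : ℝ)⁻¹) ^ (K - n)) (bgOfCfg F K U₀)) →
          NegSize (F.L : ℝ) (((F.L : ℝ)⁻¹) ^ (K - n)) (fun _ : Bond 3 (periodsT3 F K) => K - n) 3 (Matrix (Fin 2) (Fin 2) ℂ)}
    {H₁ : (PBond (F.P n) 0 → Matrix (Fin 2) (Fin 2) ℂ) →L[ℂ]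
          Space115 (F.L : ℝ) (((F.L : ℝ)⁻¹) ^ (K - n)) (fun _ : Bond 3 (periodsT3 F K) => K - n) (fun _ : Bond 3 (periodsT3 F K) × Fin 3 => K - n)
            (nabla115 (((F.L : ℝ)⁻¹) ^ (K - n)) (bgOfCfg F K U₀))}
    {B : PBond (F.P n) 0 → Matrix (Fin 2) (Fin 2) ℂ}
    {H : (PBond (F.P n) 0 → Matrix (Fin 2) (Fin 2) ℂ) →ₗ[ℂ] (PBond (F.P K) 0 → Matrix (Fin 2) (Fin 2) ℂ)}
    -- Prop. 3 for the twisted chart with (45)–(46)-tw (DISPLAYED in the knit)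
    (h47 : Chart47T3tw F n K h C₂ ε U₀ H) (hQH : ∀ Y, QTw F n K h U₀ (H Y) = Y)
    -- CHART-Σ (PROVED in the knit)
    (hSig : ChartSigmaT3 F n K e U₀)
    -- the `log` window of the twisted average at chart points of (19)-size `< e` (DISPLAYED in the knit)
    (hwin : ∀ X : PBond (F.P K) 0 → Matrix (Fin 2) (Fin 2) ℂ, (∀ b : PBond (F.P K) 0, (X b).IsHermitian ∧ Matrix.trace (X b) = 0) → nMax19 F n K U₀ X < e →
      ∀ c : PBond (F.P n) 0, ‖((dbarTw F n K h U₀ (fun b => Complex.I • X b) c : (Matrix (Fin 2) (Fin 2) ℂ)ˣ) : Matrix (Fin 2) (Fin 2) ℂ) - 1‖ < 1)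
    -- (CH5EL-tw) the displayed remainder: (112) ∘ Prop. 5 ∘ (123)–(140) ∘ (102)–(103) ∘ E–L in the twisted letters
    (hXtw : ∀ A₁ : Space115 (F.L : ℝ) (((F.L : ℝ)⁻¹) ^ (K - n)) (fun _ : Bond 3 (periodsT3 F K) => K - n) (fun _ : Bond 3 (periodsT3 F K) × Fin 3 => K - n)
            (nabla115 (((F.L : ℝ)⁻¹) ^ (K - n)) (bgOfCfg F K U₀)),
      ‖A₁‖ < ε₄ → A₁ + 𝒢 (Jcur (bgOfCfg F K U₀)) + 𝒢 (W (A₁ + H₁ B)) = 0 →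
        ∃ (A' : PBond (F.P K) 0 → Matrix (Fin 2) (Fin 2) ℂ) (X : PBond (F.P K) 0 → Matrix (Fin 2) (Fin 2) ℂ),
          ‖A'‖ < ε ∧
          QTw F n K h U₀ A' = (fun c => mlog (((unitsField (toUField V) c * (unitsField (toUField (descendTo F ℰp n K h U₀)) c)⁻¹ :
              (Matrix (Fin 2) (Fin 2) ℂ)ˣ) : Matrix (Fin 2) (Fin 2) ℂ))) ∧
          (∀ b : PBond (F.P K) 0, (X b).IsHermitian ∧ Matrix.trace (X b) = 0) ∧
          A' - H (Dfix (CmapTw F n K h U₀) H C₂ A') = (fun b => Complex.I • X b) ∧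
          nMax19 F n K U₀ X ≤ M * (‖A₁‖ + ‖H₁ B‖) ∧ IsLandauPrint F n K U₀ X ∧
          (∀ u : GaugeTransf (F.P K) 0 (Matrix.specialUnitaryGroup (Fin 2) ℂ), RestrictedPrint F n K U₀ u →
            GaugeField.gaugeAct u (emb15 U₀ (expHermField X)) ∈ fibre F ℰp n K h V →
            ∀ γ : ℝ → GaugeField (F.P K) 0 (Matrix.specialUnitaryGroup (Fin 2) ℂ), γ 0 = GaugeField.gaugeAct u (emb15 U₀ (expHermField X)) →
              (∀ t, γ t ∈ fibre F ℰp n K h V) →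
              (∀ b, DifferentiableAt ℝ (fun t => ((γ t b : Matrix.specialUnitaryGroup (Fin 2) ℂ) : Matrix (Fin 2) (Fin 2) ℂ)) 0) →
                deriv (fun t => wilsonAction4 (γ t)) 0 = 0))
    (hM : 0 ≤ M) (hMe : M * (ε₄ + ‖H₁ B‖) < e) :
    ∀ A₁ : Space115 (F.L : ℝ) (((F.L : ℝ)⁻¹) ^ (K - n)) (fun _ : Bond 3 (periodsT3 F K) => K - n) (fun _ : Bond 3 (periodsT3 F K) × Fin 3 => K - n)
          (nabla115 (((F.L : ℝ)⁻¹) ^ (K - n)) (bgOfCfg F K U₀)),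
      ‖A₁‖ < ε₄ → A₁ + 𝒢 (Jcur (bgOfCfg F K U₀)) + 𝒢 (W (A₁ + H₁ B)) = 0 →
        ∃ X : PBond (F.P K) 0 → Matrix (Fin 2) (Fin 2) ℂ,
          (∀ b : PBond (F.P K) 0, (X b).IsHermitian ∧ Matrix.trace (X b) = 0) ∧
          nMax19 F n K U₀ X ≤ M * (‖A₁‖ + ‖H₁ B‖) ∧ AvgCondPrint F n K h V U₀ X ∧ IsLandauPrint F n K U₀ X ∧
          (∀ u : GaugeTransf (F.P K) 0 (Matrix.specialUnitaryGroup (Fin 2) ℂ), RestrictedPrint F n K U₀ u →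
            GaugeField.gaugeAct u (emb15 U₀ (expHermField X)) ∈ fibre F ℰp n K h V →
            ∀ γ : ℝ → GaugeField (F.P K) 0 (Matrix.specialUnitaryGroup (Fin 2) ℂ), γ 0 = GaugeField.gaugeAct u (emb15 U₀ (expHermField X)) →
              (∀ t, γ t ∈ fibre F ℰp n K h V) →
              (∀ b, DifferentiableAt ℝ (fun t => ((γ t b : Matrix.specialUnitaryGroup (Fin 2) ℂ) : Matrix (Fin 2) (Fin 2) ℂ)) 0) →
                deriv (fun t => wilsonAction4 (γ t)) 0 = 0) := by
  intro A₁ hA₁ h111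
  obtain ⟨A', X, hA', hQA', hX, hAX, hsize, h21, hEL⟩ := hXtw A₁ hA₁ h111
  refine ⟨X, hX, hsize, ?_, h21, hEL⟩
  -- the (19)-size of `X` is below CHART-Σ's radius `e`
  have hlt : nMax19 F n K U₀ X < e := by
    have h1 : M * (‖A₁‖ + ‖H₁ B‖) ≤ M * (ε₄ + ‖H₁ B‖) := mul_le_mul_of_nonneg_left (by linarith) hM
    exact lt_of_le_of_lt (hsize.trans h1) hMe
  -- [Balaban1985RegularSpaces] Prop. 7: the chart point `e^{iX}U₀` is printed-regular of radius `178(ε₀ + e)`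
  have hL0 : (0 : ℝ) < (F.L : ℝ) := Fact.out
  have hL1 : (1 : ℝ) ≤ (F.L : ℝ) := by have := F.hL.2; exact_mod_cast (by omega : 1 ≤ F.L)
  have hL3 : (1 : ℝ) ≤ (F.L : ℝ) ^ 3 := one_le_pow₀ hL1
  have hε₂ : ε₀ + e ≤ 1 / 4 := by linarith
  have hε₂0 : 0 < ε₀ + e := by linarith
  have h19 : In19 F n K (ε₀ + e) U₀ (expHermField X) X := in19_expHermField_of_nMax19_lt hX (hlt.trans_le (by linarith))
  have hU₁ : RegPr F n K (178 * (ε₀ + e)) (emb15 U₀ (expHermField X)) := regPr_emb15_of_in19 F n K hε₂ (by linarith) hreg h19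
  have hε₁0 : 0 < 178 * (ε₀ + e) := by positivity
  -- the background's window `10⁷L³ε₀ ≤ 1` from `10⁷L³·178(ε₀ + e) ≤ 1`
  have hε₀' : 10 ^ 7 * (F.L : ℝ) ^ 3 * ε₀ ≤ 1 := by
    have h1 : ε₀ ≤ 178 * (ε₀ + e) := by nlinarith
    have h2 : (0 : ℝ) ≤ 10 ^ 7 * (F.L : ℝ) ^ 3 := by positivity
    exact (mul_le_mul_of_nonneg_left h1 h2).trans hw137
  -- (20) in the Σ_k form: CHART-Σ's restricted axial `u` + the fibre clause as a THEOREM (★w5-20520 g3)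
  have hfib := fibreClause_of_chart47tw F h hε₀ hε₀' hε₁0 hw137 hreg h47 hQH V A' hA' hQA' hX hAX hU₁ (hwin X hX hlt)
    (norm_datum_sub_one_lt_of_closeAvg F h hb V U₀ hclose)
  obtain ⟨u, hu, hax⟩ := hSig X hX hlt
  intro U₁ hU₁eq
  have hU₁X : U₁ = expHermField X := by
    funext b'
    apply Subtype.ext
    rw [hU₁eq b', expHermField_apply, coe_expHerm (hX b')]
  subst hU₁X
  exact ⟨u, hu, hax, hfib u hu hax⟩

end Summit.QuantumFields.YangMills.Theorems.Prop7ChartPiecesTw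

end
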